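import Summits.ValiantsHypothesis.ValiantsHypothesis.Theses.BorderApolarity

/-!
# `ToricFixedPoints` / line `form_then_lift`, stub F1 (`stub_formDebordering`): the padded
`3 × 3` permutation-monomial forms `ℓ^{m-3}·(Σ_σ a_σ y_σ)` satisfy F1's `H₀(3,m)`-hypothesis exactly

The director's independent kill target for F1 is the padded cubic `ℓ²·G₃` at `m = 5`
(`G₃ = y₀₀y₁₁y₂₂ + y₀₁y₁₂y₂₀ + y₀₂y₁₀y₂₁`, `dc(G₃) = 7`: `FormDeborderingG3Dc.lean`).  F1 has four
hypotheses on `F`: (orbit data) `P_t ∈ GL·det_m`, `F ≠ 0`, the coefficientwise limit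
`c_t • P_t → F`, and `H₀(n,m)`-semi-invariance (`M·F = e • F` for every `M` in the route's
`H₀`-block: columns of the corner block and of `(0,0)` diagonal, rank-one pattern on the block,
normalised).  This file discharges the two STRUCTURAL ones in the kernel, for every `m ≥ 3` and every
form `F = ℓ^{m-3}·(a₁ y₀₀y₁₁y₂₂ + a₂ y₀₁y₁₂y₂₀ + a₃ y₀₂y₁₀y₂₁ + a₄ y₀₀y₁₂y₂₁ + a₅ y₀₁y₁₀y₂₂ + a₆ y₀₂y₁₁y₂₀)`
(`ℓ = X (0,0)`, `y_ab = X (m-3+a, m-3+b)`; `G₃`, `per₃`, `det₃` padded are the cases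
`a = (1,1,1,0,0,0), (1,…,1), (1,1,1,-1,-1,-1)`):

* `paddedPerm3_linSubst_eq_smul` — under F1's column condition (2) and rank-one condition (3) alone,
  `M·F = (M₀₀^{m-3}·N₀₀N₁₁N₂₂) • F` (`N_ab = M_{(a,b),(a,b)}` on the block): every permutation
  monomial picks up the same torus character because of the rank-one relations;
* `paddedPerm3_H0` — literally the fourth hypothesis of `stub_formDebordering` at `n = 3`
  (all four conditions, `∀ A : GL`), conclusion `∃ e, M·F = e • F`;
* `paddedPerm3_ne_zero` — `F ≠ 0` as soon as `a₁ ≠ 0`.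

Consequence (recorded, not restated as a theorem): for this family F1 at `(3,m)` is EXACTLY the
border-membership question "is `ℓ^{m-3}·G` a coefficientwise limit of `c_t • P_t`, `P_t ∈ GL·det_m`,
without being of toric shape?" — for `G₃` only `m ∈ {5,6}` is open (`m ≤ 4`: LMR dual bound;
`m ≥ 7 = dc`: End-type, toric by `FormDeborderingEndType.lean`).  Refuter/theory seat
`val-width-5779-d1` (stmt-ValiantsHypothesis-5779).  VP ≠ VNP is not touched.
-/

open MvPolynomial Finset
open Literature.Computability.AlgebraicComplexity

namespace Summit.ValiantsHypothesis.Cruxes.ToricFixedPoints.Negative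

/-- A substitution matrix whose column `v` is diagonal rescales the variable `X v`. [folklore] -/
theorem linSubst_X_of_column_diagonal {σ : Type*} [Fintype σ] [DecidableEq σ] {K : Type*} [Field K]
    (M : Matrix σ σ K) (v : σ) (h : ∀ j, j ≠ v → M j v = 0) :
    linSubst σ K M (X v) = C (M v v) * X v := by
  rw [linSubst_X, Finset.sum_eq_single v (fun j _ hj => by rw [h j hj, zero_smul])
    (fun hv => absurd (Finset.mem_univ v) hv), smul_eq_C_mul]

/-- Rank-one relations `N_ab N_cd = N_ad N_cb` force every `3 × 3` permutation product
`∏ₐ N_{a,σ a}` to equal the diagonal product `N₀₀N₁₁N₂₂`. [folklore] -/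
theorem perm3_prod_eq_diag {K : Type*} [CommRing K] (N : Fin 3 → Fin 3 → K)
    (h : ∀ a b c d : Fin 3, N a b * N c d = N a d * N c b) :
    N 0 1 * N 1 2 * N 2 0 = N 0 0 * N 1 1 * N 2 2 ∧
    N 0 2 * N 1 0 * N 2 1 = N 0 0 * N 1 1 * N 2 2 ∧
    N 0 0 * N 1 2 * N 2 1 = N 0 0 * N 1 1 * N 2 2 ∧
    N 0 1 * N 1 0 * N 2 2 = N 0 0 * N 1 1 * N 2 2 ∧
    N 0 2 * N 1 1 * N 2 0 = N 0 0 * N 1 1 * N 2 2 := by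
  refine ⟨?_, ?_, ?_, ?_, ?_⟩
  · linear_combination (N 2 0) * h 0 1 1 2 + (N 1 1) * h 0 2 2 0
  · linear_combination (N 1 0) * h 0 2 2 1 + (N 2 2) * h 0 1 1 0
  · linear_combination (N 0 0) * h 1 2 2 1
  · linear_combination (N 2 2) * h 0 1 1 0
  · linear_combination (N 1 1) * h 0 2 2 0

/-- **The padded permutation-monomial forms are `H₀(3,m)`-semi-invariant.**  For `m ≥ 3`, any
coefficients `a₁…a₆` and any substitution matrix `M` satisfying F1's column condition (2) (the
columns of the corner-block variables and of `ℓ = X(0,0)` are diagonal) and rank-one condition (3)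
on the block, `M·F = (M₀₀^{m-3} N₀₀N₁₁N₂₂) • F`. [folklore] -/
theorem paddedPerm3_linSubst_eq_smul (m : ℕ) [NeZero m] (hm : 3 ≤ m) (a₁ a₂ a₃ a₄ a₅ a₆ : ℂ)
    (M : Matrix (Fin m × Fin m) (Fin m × Fin m) ℂ)
    (h2 : ∀ i j : Fin m × Fin m, ((m - 3 ≤ (i.1 : ℕ) ∧ m - 3 ≤ (i.2 : ℕ)) ∨ i = (0, 0)) →
      j ≠ i → M j i = 0)
    (h3 : ∀ i k j l : Fin m, m - 3 ≤ (i : ℕ) → m - 3 ≤ (k : ℕ) → m - 3 ≤ (j : ℕ) → m - 3 ≤ (l : ℕ) →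
      M (i, j) (i, j) * M (k, l) (k, l) = M (i, l) (i, l) * M (k, j) (k, j)) :
    let y : Fin 3 → Fin 3 → MvPolynomial (Fin m × Fin m) ℂ :=
      fun a b => X (⟨m - 3 + a, by omega⟩, ⟨m - 3 + b, by omega⟩)
    let F : MvPolynomial (Fin m × Fin m) ℂ :=
      X ((0 : Fin m), (0 : Fin m)) ^ (m - 3) *
        (C a₁ * (y 0 0 * y 1 1 * y 2 2) + C a₂ * (y 0 1 * y 1 2 * y 2 0) +
          C a₃ * (y 0 2 * y 1 0 * y 2 1) + C a₄ * (y 0 0 * y 1 2 * y 2 1) +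
          C a₅ * (y 0 1 * y 1 0 * y 2 2) + C a₆ * (y 0 2 * y 1 1 * y 2 0))
    let N : Fin 3 → Fin 3 → ℂ := fun a b =>
      M (⟨m - 3 + a, by omega⟩, ⟨m - 3 + b, by omega⟩) (⟨m - 3 + a, by omega⟩, ⟨m - 3 + b, by omega⟩)
    linSubst (Fin m × Fin m) ℂ M F =
      (M (0, 0) (0, 0) ^ (m - 3) * (N 0 0 * N 1 1 * N 2 2)) • F := by
  intro y F N
  -- the ten variables are rescaled
  have hℓ : linSubst (Fin m × Fin m) ℂ M (X ((0 : Fin m), (0 : Fin m))) =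
      C (M (0, 0) (0, 0)) * X ((0 : Fin m), (0 : Fin m)) :=
    linSubst_X_of_column_diagonal M _ fun j hj => h2 _ j (Or.inr rfl) hj
  have hy : ∀ a b : Fin 3, linSubst (Fin m × Fin m) ℂ M (y a b) = C (N a b) * y a b := fun a b =>
    linSubst_X_of_column_diagonal M _ fun j hj =>
      h2 _ j (Or.inl ⟨Nat.le_add_right _ _, Nat.le_add_right _ _⟩) hj
  -- the rank-one relations on the block
  have hN : ∀ a b c d : Fin 3, N a b * N c d = N a d * N c b := fun a b c d =>
    h3 _ _ _ _ (Nat.le_add_right _ _) (Nat.le_add_right _ _) (Nat.le_add_right _ _)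
      (Nat.le_add_right _ _)
  obtain ⟨e₂, e₃, e₄, e₅, e₆⟩ := perm3_prod_eq_diag N hN
  have c₂ : C (N 0 1) * C (N 1 2) * C (N 2 0) = (C (N 0 0) * C (N 1 1) * C (N 2 2) :
      MvPolynomial (Fin m × Fin m) ℂ) := by
    rw [← map_mul, ← map_mul, e₂, map_mul, map_mul]
  have c₃ : C (N 0 2) * C (N 1 0) * C (N 2 1) = (C (N 0 0) * C (N 1 1) * C (N 2 2) :
      MvPolynomial (Fin m × Fin m) ℂ) := by
    rw [← map_mul, ← map_mul, e₃, map_mul, map_mul]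
  have c₄ : C (N 0 0) * C (N 1 2) * C (N 2 1) = (C (N 0 0) * C (N 1 1) * C (N 2 2) :
      MvPolynomial (Fin m × Fin m) ℂ) := by
    rw [← map_mul, ← map_mul, e₄, map_mul, map_mul]
  have c₅ : C (N 0 1) * C (N 1 0) * C (N 2 2) = (C (N 0 0) * C (N 1 1) * C (N 2 2) :
      MvPolynomial (Fin m × Fin m) ℂ) := by
    rw [← map_mul, ← map_mul, e₅, map_mul, map_mul]
  have c₆ : C (N 0 2) * C (N 1 1) * C (N 2 0) = (C (N 0 0) * C (N 1 1) * C (N 2 2) :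
      MvPolynomial (Fin m × Fin m) ℂ) := by
    rw [← map_mul, ← map_mul, e₆, map_mul, map_mul]
  simp only [F, map_mul, map_pow, map_add, linSubst_C, hℓ, hy, smul_eq_C_mul]
  set L := (X ((0 : Fin m), (0 : Fin m)) : MvPolynomial (Fin m × Fin m) ℂ)
  linear_combination
    (C (M (0, 0) (0, 0)) * L) ^ (m - 3) *
      (C a₂ * (y 0 1 * y 1 2 * y 2 0) * c₂ + C a₃ * (y 0 2 * y 1 0 * y 2 1) * c₃ +
        C a₄ * (y 0 0 * y 1 2 * y 2 1) * c₄ + C a₅ * (y 0 1 * y 1 0 * y 2 2) * c₅ +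
        C a₆ * (y 0 2 * y 1 1 * y 2 0) * c₆)

/-- **Hypothesis (4) of `stub_formDebordering` at `n = 3`, verbatim, for the padded
permutation-monomial forms.**  For every `A ∈ GL` whose matrix `M` satisfies the four `H₀(3,m)`
conditions of F1 (order filter (1), diagonal columns (2), rank-one block (3), normalisation (4)),
`M·F = e • F` for some `e` (in fact `e = M₀₀^{m-3} N₀₀N₁₁N₂₂`, which (4) makes `1`; conditions (1)
and (4) are not needed). [folklore] -/
theorem paddedPerm3_H0 (m : ℕ) [NeZero m] (hm : 3 ≤ m) (a₁ a₂ a₃ a₄ a₅ a₆ : ℂ) :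
    let rk := fun (p : Fin m × Fin m) =>
      (if (m - 3 ≤ (p.1 : ℕ) ∧ m - 3 ≤ (p.2 : ℕ)) ∨ p = (0, 0) then 0 else m * m) +
        ((p.1 : ℕ) * m + (p.2 : ℕ))
    let y : Fin 3 → Fin 3 → MvPolynomial (Fin m × Fin m) ℂ :=
      fun a b => X (⟨m - 3 + a, by omega⟩, ⟨m - 3 + b, by omega⟩)
    let F : MvPolynomial (Fin m × Fin m) ℂ :=
      X ((0 : Fin m), (0 : Fin m)) ^ (m - 3) *
        (C a₁ * (y 0 0 * y 1 1 * y 2 2) + C a₂ * (y 0 1 * y 1 2 * y 2 0) +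
          C a₃ * (y 0 2 * y 1 0 * y 2 1) + C a₄ * (y 0 0 * y 1 2 * y 2 1) +
          C a₅ * (y 0 1 * y 1 0 * y 2 2) + C a₆ * (y 0 2 * y 1 1 * y 2 0))
    ∀ A : Matrix.GeneralLinearGroup (Fin m × Fin m) ℂ,
      let M : Matrix (Fin m × Fin m) (Fin m × Fin m) ℂ := A
      (∀ i j : Fin m × Fin m, M j i ≠ 0 → rk j ≤ rk i) →
      (∀ i j : Fin m × Fin m, ((m - 3 ≤ (i.1 : ℕ) ∧ m - 3 ≤ (i.2 : ℕ)) ∨ i = (0, 0)) →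
        j ≠ i → M j i = 0) →
      (∀ i k j l : Fin m, m - 3 ≤ (i : ℕ) → m - 3 ≤ (k : ℕ) → m - 3 ≤ (j : ℕ) → m - 3 ≤ (l : ℕ) →
        M (i, j) (i, j) * M (k, l) (k, l) = M (i, l) (i, l) * M (k, j) (k, j)) →
      M (0, 0) (0, 0) ^ (m - 3) * ∏ i ∈ Finset.univ.filter (fun i : Fin m => m - 3 ≤ (i : ℕ)),
        M (i, i) (i, i) = 1 →
      ∃ e : ℂ, linSubst (Fin m × Fin m) ℂ M F = e • F := by
  intro rk y F A M _ h2 h3 _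
  exact ⟨_, paddedPerm3_linSubst_eq_smul m hm a₁ a₂ a₃ a₄ a₅ a₆ M h2 h3⟩

/-- The padded permutation-monomial form is non-zero as soon as `a₁ ≠ 0` (evaluate at `ℓ = 1`,
`Y = 1`): hypothesis `F ≠ 0` of `stub_formDebordering` for `ℓ^{m-3}G₃`, `ℓ^{m-3}per₃`,
`ℓ^{m-3}det₃`. [folklore] -/
theorem paddedPerm3_ne_zero (m : ℕ) [NeZero m] (hm : 3 ≤ m) (a₁ a₂ a₃ a₄ a₅ a₆ : ℂ)
    (ha : a₁ ≠ 0) :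
    let y : Fin 3 → Fin 3 → MvPolynomial (Fin m × Fin m) ℂ :=
      fun a b => X (⟨m - 3 + a, by omega⟩, ⟨m - 3 + b, by omega⟩)
    X ((0 : Fin m), (0 : Fin m)) ^ (m - 3) *
        (C a₁ * (y 0 0 * y 1 1 * y 2 2) + C a₂ * (y 0 1 * y 1 2 * y 2 0) +
          C a₃ * (y 0 2 * y 1 0 * y 2 1) + C a₄ * (y 0 0 * y 1 2 * y 2 1) +
          C a₅ * (y 0 1 * y 1 0 * y 2 2) + C a₆ * (y 0 2 * y 1 1 * y 2 0)) ≠ 0 := by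
  intro y h
  have key := congr_arg (MvPolynomial.eval fun p : Fin m × Fin m => if p.1 = p.2 then (1 : ℂ) else 0) h
  have h01 : ((⟨m - 3 + ((0 : Fin 3) : ℕ), by omega⟩ : Fin m) = ⟨m - 3 + ((1 : Fin 3) : ℕ), by omega⟩)
      = False := by
    simp [Fin.ext_iff]
  have h02 : ((⟨m - 3 + ((0 : Fin 3) : ℕ), by omega⟩ : Fin m) = ⟨m - 3 + ((2 : Fin 3) : ℕ), by omega⟩)
      = False := by
    simp [Fin.ext_iff]
  have h12 : ((⟨m - 3 + ((1 : Fin 3) : ℕ), by omega⟩ : Fin m) = ⟨m - 3 + ((2 : Fin 3) : ℕ), by omega⟩)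
      = False := by
    simp [Fin.ext_iff]
  have h10 : ((⟨m - 3 + ((1 : Fin 3) : ℕ), by omega⟩ : Fin m) = ⟨m - 3 + ((0 : Fin 3) : ℕ), by omega⟩)
      = False := by
    simp [Fin.ext_iff]
  have h20 : ((⟨m - 3 + ((2 : Fin 3) : ℕ), by omega⟩ : Fin m) = ⟨m - 3 + ((0 : Fin 3) : ℕ), by omega⟩)
      = False := by
    simp [Fin.ext_iff]
  have h21 : ((⟨m - 3 + ((2 : Fin 3) : ℕ), by omega⟩ : Fin m) = ⟨m - 3 + ((1 : Fin 3) : ℕ), by omega⟩)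
      = False := by
    simp [Fin.ext_iff]
  simp only [y, map_mul, map_pow, map_add, eval_C, eval_X, if_true, h01, h02, h12, h10, h20, h21,
    if_false, mul_one, mul_zero, add_zero, one_pow, one_mul, map_zero] at key
  exact ha key

end Summit.ValiantsHypothesis.Cruxes.ToricFixedPoints.Negative
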